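import Summits.BirchSwinnertonDyer.BirchSwinnertonDyer.Theorems.PrintCf2RubinValueTwoTwistedKummerScalar
import Summits.BirchSwinnertonDyer.BirchSwinnertonDyer.Theorems.PrintCf2RubinValueTwoRowTwoKernelResCor
import Literature.NumberTheory.EllipticCurves.Kato2004.IwasawaCohomologyNumberFieldResCor
import HarnessLib

/-!
# Twisted Kummer classes under RESTRICTION, `cor ∘ res = index` in ty2's level currency, and the θ-TWISTED CORESTRICTION of the
# class of a radicand fixed by the BIGGER group — the two generic vanishing mechanisms of the comparison hZC («𝒞̃ ⊆ 𝒥ζ» away from `p`)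

Cell `bsd-print-cf2`, WIDTH seat `bsd-line-cf2-p1-w5` g10 (prover-bsd-line-cf2-p1-w5-g10-0); piece (Z-arith-a) of the second half hZC of
-w6 g8's comparison item hCR on the DECIDING child stmt-BirchSwinnertonDyer-24721 (FINDING/CLAIM `HOME/STATUS` 2026-08-29T15:58:53Z):
after (Z-cl) (`…CarriersClosed`, the reduction `IwasawaCohomologyData.nsmul_mem_of_fg_of_forall_generators`), hZC is LEVELWISE: every
generator `cor_{F_{m′}→K̃_n}(κ_k(e) ⊗ t_θ)` of -w6 g9's family of record, `e` an elliptic unit of `F_{m′} = K_θ·K̃_{m′}`, must land in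
`proj_{n,k}(Z)` up to a fixed `p`-power. Two of the three mechanisms are generic cohomology and are proved here (the third — Rubin generators
versus Kato's units and de Shalit's distribution relations — is arithmetic): `--supports` 24721 (helper, Theses-free). THEOREMS ONLY
(no definition, no named fact, no instance, no `sorry`). HONEST FRAMING: bookkeeping; nothing here closes the crux; no summit statement is
proved by this seat; BSD is not proved by any of this.

WHAT (ty2's `levelCoh p S θ U k 1`, `relCores`, `levelConj`; the tree's `resLe`):
* §1 `isTwistedKummerClass_resLe` — a class of `β` at `U′` restricts to a class of `β` at every `U″ ≤ U′` (same cocycle values); with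
  -w6 g9's root independence: the class over a BIGGER field of a unit from a SMALLER field is the restriction of its class there;
* §2 `index_imGS_subgroupOf_eq` (`[U_S : U′_S] = [U : U′]` for `N_S ≤ U′`), **`relCores_resLe_eq_index_smul`** (`cor_{U/U′} ∘ res = [U : U′]` on
  `H¹(U_S, μ_{p^k} ⊗ θ)`, the tree's `Kato2004.coresLe_resLe` read through -w5 g9's `relCores_one_eq_coresLe`) — so the class of a unit of
  `F_{m″}` read at `F_{m′} ⊇ F_{m″}` cores down with the factor `[F_{m′} : F_{m″}] = p^{2(m′−m″)}`;
* §3 **`index_smul_relCores_eq_sum_smul`** — for `U′ ⊴ Γ_K` open, `U′ ≤ U`, `N_S ≤ U′`, `θ|_{U′} = 1`, a radicand `u` FIXED BY `U` with `β^{p^k} = u`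
  and a class `c′` of `β` at `U′`: `[U : U′]·cor(c′) = (Σ_{y ∈ U/U′} (θ(t_y) mod p^k))·cor(c′)` (res ∘ cor = Σ conj_{t_y} (-w6 g9), the θ-scalar
  conjugation law (FILE 1) and root independence give `res(cor c′) = (Σ θ(t_y))·c′`, then §2); **`index_smul_relCores_eq_zero_of_dvd_sum`**:
  if `p^k ∣ Σ_y (θ(t_y) mod p^k)` then `[U : U′]·cor(c′) = 0` — for `θ` quadratic and non-trivial on `U/U′ ≅ C₂` the sum is `1 + (p^k − 1)`, so the
  θ-twisted corestriction to `K̃_m` of the class of a unit of `K̃_m` is killed by `2`.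

References: J. Neukirch, A. Schmidt, K. Wingberg (2008) I §5 Prop. 1.5.3 (iii)(iv), Cor. 1.5.7; J.-P. Serre, *Galois Cohomology* I §2.4
Prop. 9; J. Johnson-Leung, G. Kings (2011) §3.3 (5), §5.4; K. Rubin (1991) §4.
-/

noncomputable section

open scoped Classical

-- the summit namespace `Summit.BirchSwinnertonDyer.BirchSwinnertonDyer` repeats the problem name by design (D-0017)
set_option linter.dupNamespace false
set_option autoImplicit false

open scoped NumberField
open Field IsDedekindDomain
open Literature.NumberTheory.GaloisRepresentations Literature.NumberTheory.GaloisRepresentations.DiscreteGaloisModule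
open Literature.NumberTheory.EllipticCurves
open Literature.NumberTheory.ComplexMultiplication.EllipticUnits
open Literature.NumberTheory.ComplexMultiplication.EllipticUnits.JohnsonLeungKings2011
open Summit.BirchSwinnertonDyer.BirchSwinnertonDyer.Theorems.PrintCf2.RowTwo

namespace Summit.BirchSwinnertonDyer.BirchSwinnertonDyer.Theorems.PrintCf2.TwistedZeta

variable {K : Type} [Field K] [NumberField K] (p : ℕ) [Fact p.Prime] (S : Set (HeightOneSpectrum (𝓞 K)))
  (θ : absoluteGaloisGroup K →ₜ* ℤ_[p]ˣ) (k : ℕ) {U U' U'' : Subgroup (absoluteGaloisGroup K)}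

/-! ## §1. Restriction of twisted Kummer classes -/

omit [NumberField K] in
/-- **A twisted Kummer class of `β` at `U′` restricts to a twisted Kummer class of `β` at `U″ ≤ U′`** (the restricted cocycle has the same
values `σβ/β`, `σ ∈ U″`). [cite: JohnsonLeungKings2011, §3.3 (5)–(6) (arXiv p0010:L61–70)] [cite: NeukirchSchmidtWingberg2008, I §5 Prop. 1.5.2] -/
theorem isTwistedKummerClass_resLe (h : U'' ≤ U') {β : (AlgebraicClosure K)ˣ} {c : levelCoh p S θ U' k 1}
    (hc : IsTwistedKummerClass p θ S U' k β c) :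
    IsTwistedKummerClass p θ S U'' k β (resLe (coeffGS p S θ k).toTopRep (imGS_le_of_le S h) 1 c) := by
  obtain ⟨φ₀, rfl, hφ⟩ := hc
  let X := (coeffGS p S θ k).toTopRep
  let φ : contOneCocycles (subgroupRep X (imGS S U')) := φ₀
  let ψ : contOneCocycles (subgroupRep X (imGS S U'')) :=
    contOneCocycles.pullback (subgroupInclusion (imGS_le_of_le S h)) (TopRep.ofHom ⟨ContinuousLinearMap.id ℤ X, fun _ => rfl⟩) φ
  refine ⟨ψ, (resLe_oneCocycleClass X (imGS_le_of_le S h) φ).symm, fun σ hσ ↦ ?_⟩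
  change muVal K (p ^ k) ((ψ.1 ⟨toUnramifiedQuot K S σ, Subgroup.mem_map_of_mem _ hσ⟩ :
      Representation.invariants ((muTwist p θ k).toRepresentation.comp (ramificationSubgroup K S).subtype)) :
        MuCarrier K (p ^ k)) = _
  rw [contOneCocycles.pullback_apply, TopRep.hom_ofHom, ← hφ σ (h hσ)]
  rfl

omit [NumberField K] in
/-- **The class at a SMALLER group is the restriction of the class at the BIGGER one**: if `c″` at `U″ ≤ U′` and `c′` at `U′` are twisted
Kummer classes of radicands with the same `p^k`-th power (`θ|_{U″} = 1`, `θ|_{N_S} = 1`, `N_S` fixing `μ_{p^k}`), then `c″ = res c′` (-w6 g9's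
root independence + -w6 g8's uniqueness). [cite: JohnsonLeungKings2011, §3.3 (5)–(6) and Cor. 3.4 (arXiv p0010:L40–70)] -/
theorem eq_resLe_of_isTwistedKummerClass (h : U'' ≤ U') (hθU : ∀ σ ∈ U'', θ σ = 1) (hθN : ∀ τ ∈ ramificationSubgroup K S, θ τ = 1)
    (hμN : ∀ τ ∈ ramificationSubgroup K S, ∀ ζ : (AlgebraicClosure K)ˣ, ζ ^ (p ^ k) = 1 → τ • ζ = ζ)
    {β' β'' : (AlgebraicClosure K)ˣ} (hββ : β'' ^ (p ^ k) = β' ^ (p ^ k)) {c' : levelCoh p S θ U' k 1} {c'' : levelCoh p S θ U'' k 1}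
    (hc' : IsTwistedKummerClass p θ S U' k β' c') (hc'' : IsTwistedKummerClass p θ S U'' k β'' c'') :
    c'' = resLe (coeffGS p S θ k).toTopRep (imGS_le_of_le S h) 1 c' :=
  (eq_of_isTwistedKummerClass_of_pow_eq p S θ k U'' hθU hθN hμN hββ (isTwistedKummerClass_resLe p S θ k h hc') hc'').symm

/-! ## §2. `cor ∘ res = index` -/

omit [NumberField K] in
/-- **`[U_S : U′_S] = [U : U′]`** for `N_S ≤ U′ ≤ U` (`Γ_K ↠ G_S` induces `U/U′ ≃ U_S/U′_S`, -w6 g8's `exists_quotientEquiv_imGS`).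
[cite: NeukirchSchmidtWingberg2008, I §5 (cor via coset representatives)] -/
theorem index_imGS_subgroupOf_eq (hN : ramificationSubgroup K S ≤ U') :
    ((imGS S U').subgroupOf (imGS S U)).index = (U'.subgroupOf U).index := by
  obtain ⟨e, -⟩ := exists_quotientEquiv_imGS S (U := U) (U' := U') hN
  exact (Nat.card_congr e).symm

/-- **`cor_{U/U′} ∘ res_{U′/U} = [U : U′]` on `H¹(U_S, μ_{p^k} ⊗ θ)`** in ty2's level currency (`relCores` = the tree's `coresLe` in degree one,
-w5 g9; the tree's `Kato2004.coresLe_resLe`). [cite: NeukirchSchmidtWingberg2008, I §5 Cor. 1.5.7] [cite: SerreGaloisCohomology1997, I §2.4 Prop. 9] -/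
theorem relCores_resLe_eq_index_smul (h : U' ≤ U) (hU : IsOpen (U : Set (absoluteGaloisGroup K)))
    (hU' : IsOpen (U' : Set (absoluteGaloisGroup K))) (hN : ramificationSubgroup K S ≤ U') (c : levelCoh p S θ U k 1) :
    relCores p S θ h hU hU' k 1 (resLe (coeffGS p S θ k).toTopRep (imGS_le_of_le S h) 1 c) = ((U'.subgroupOf U).index : ℤ) • c := by
  haveI : ((imGS S U').subgroupOf (imGS S U)).FiniteIndex := by
    haveI := finiteIndex_imGS' S hU'
    infer_instance
  letI : Fintype (↥(imGS S U) ⧸ (imGS S U').subgroupOf (imGS S U)) := Fintype.ofFinite _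
  rw [relCores_one_eq_coresLe, Kato2004.coresLe_resLe, index_imGS_subgroupOf_eq S (U := U) hN]
  exact int_smul_eq_zsmul _ _ _

/-- **COROLLARY (the lower-layer mechanism of hZC)**: for `U″ ≤ U′ ≤ U` and a radicand whose class exists at the bigger group `U″`… stated as
used: if `c′` at `U′` is a class of `β′` and `c″` at `U″ ≤ U′` a class of `β″` with `β″^{p^k} = β′^{p^k}` (a unit of the SMALLER field read in
the BIGGER one), then `cor_{U′/U″} c″ = [U′ : U″]·c′`. [cite: NeukirchSchmidtWingberg2008, I §5 Cor. 1.5.7] [cite: JohnsonLeungKings2011, §3.3 (5)–(6)] -/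
theorem relCores_eq_index_smul_of_isTwistedKummerClass (h : U'' ≤ U') (hU' : IsOpen (U' : Set (absoluteGaloisGroup K)))
    (hU'' : IsOpen (U'' : Set (absoluteGaloisGroup K))) (hN : ramificationSubgroup K S ≤ U'') (hθU : ∀ σ ∈ U'', θ σ = 1)
    (hθN : ∀ τ ∈ ramificationSubgroup K S, θ τ = 1)
    (hμN : ∀ τ ∈ ramificationSubgroup K S, ∀ ζ : (AlgebraicClosure K)ˣ, ζ ^ (p ^ k) = 1 → τ • ζ = ζ)
    {β' β'' : (AlgebraicClosure K)ˣ} (hββ : β'' ^ (p ^ k) = β' ^ (p ^ k)) {c' : levelCoh p S θ U' k 1} {c'' : levelCoh p S θ U'' k 1}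
    (hc' : IsTwistedKummerClass p θ S U' k β' c') (hc'' : IsTwistedKummerClass p θ S U'' k β'' c'') :
    relCores p S θ h hU' hU'' k 1 c'' = ((U''.subgroupOf U').index : ℤ) • c' := by
  rw [eq_resLe_of_isTwistedKummerClass p S θ k h hθU hθN hμN hββ hc' hc'', relCores_resLe_eq_index_smul p S θ k h hU' hU'' hN]

/-! ## §3. The θ-twisted corestriction of the class of a radicand fixed by the bigger group -/

/-- **`[U : U′]·cor(c′) = (Σ_{y ∈ U/U′} (θ(t_y) mod p^k))·cor(c′)`** for `U′ ⊴ Γ_K` open, `U′ ≤ U` open, `N_S ≤ U′`, `θ|_{U′} = 1`, a radicand `u`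
FIXED BY `U`, `β^{p^k} = u`, `c′` a class of `β` at `U′`, `t` a system of representatives of `U/U′`: `res(cor c′) = Σ_y conj_{t_y} c′` (-w6 g9) and
`conj_{t_y} c′ = (θ(t_y) mod p^k)·(class of t_yβ) = (θ(t_y) mod p^k)·c′` (the θ-scalar conjugation law; `(t_yβ)^{p^k} = t_y u = u`, root independence);
then `cor ∘ res = [U : U′]` (§2). [cite: JohnsonLeungKings2011, §3.3 (5) (arXiv p0010:L61–70)] [cite: NeukirchSchmidtWingberg2008, I §5 Prop. 1.5.3 (iii)(iv), Cor. 1.5.7] -/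
theorem index_smul_relCores_eq_sum_smul [U'.Normal] (h : U' ≤ U) (hU : IsOpen (U : Set (absoluteGaloisGroup K)))
    (hU' : IsOpen (U' : Set (absoluteGaloisGroup K))) (hN : ramificationSubgroup K S ≤ U') (hθU' : ∀ σ ∈ U', θ σ = 1)
    (hμN : ∀ τ ∈ ramificationSubgroup K S, ∀ ζ : (AlgebraicClosure K)ˣ, ζ ^ (p ^ k) = 1 → τ • ζ = ζ)
    [Fintype (U ⧸ U'.subgroupOf U)] {t : U ⧸ U'.subgroupOf U → U} (ht : ∀ y, (t y : U ⧸ U'.subgroupOf U) = y)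
    {u β : (AlgebraicClosure K)ˣ} (hu : ∀ σ ∈ U, σ • u = u) (hβ : β ^ (p ^ k) = u) {c' : levelCoh p S θ U' k 1}
    (hc' : IsTwistedKummerClass p θ S U' k β c') :
    ((U'.subgroupOf U).index : ℤ) • relCores p S θ h hU hU' k 1 c' =
      (∑ y, ((PadicInt.toZModPow k ((θ ((t y : U) : absoluteGaloisGroup K) : ℤ_[p]ˣ) : ℤ_[p])).val : ℤ)) • relCores p S θ h hU hU' k 1 c' := by
  have hθN : ∀ τ ∈ ramificationSubgroup K S, θ τ = 1 := fun τ hτ ↦ hθU' τ (hN hτ)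
  -- `conj_{t_y} c′ = (θ(t_y) mod p^k)·c′`
  have hconj : ∀ y, levelConj p S θ U' k 1 ((t y : U) : absoluteGaloisGroup K) c' =
      (PadicInt.toZModPow k ((θ ((t y : U) : absoluteGaloisGroup K) : ℤ_[p]ˣ) : ℤ_[p])).val • c' := by
    intro y
    have hty : IsTwistedKummerClass p θ S U' k (((t y : U) : absoluteGaloisGroup K) • β) c' :=
      (isTwistedKummerClass_iff_of_pow_eq p S θ k U' hθU' hθN hμN (β := β) (β' := ((t y : U) : absoluteGaloisGroup K) • β)
        (by rw [← smul_pow', hβ, hu _ (t y).2]) c').mp hc'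
    exact isTwistedKummerClass_unique p S θ k U' (isTwistedKummerClass_levelConj_pow p S θ k U' hc' _)
      (isTwistedKummerClass_pow p S θ k U' hty _)
  -- `res (cor c′) = (Σ_y θ(t_y))·c′`
  have hres : (resLe (coeffGS p S θ k).toTopRep (imGS_le_of_le S h) 1 (relCores p S θ h hU hU' k 1 c') : levelCoh p S θ U' k 1) =
      (∑ y, ((PadicInt.toZModPow k ((θ ((t y : U) : absoluteGaloisGroup K) : ℤ_[p]ˣ) : ℤ_[p])).val : ℤ)) • c' := by
    have hsum : ((∑ y, ((PadicInt.toZModPow k ((θ ((t y : U) : absoluteGaloisGroup K) : ℤ_[p]ˣ) : ℤ_[p])).val : ℤ)) • c' :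
        levelCoh p S θ U' k 1) = ∑ y, levelConj p S θ U' k 1 ((t y : U) : absoluteGaloisGroup K) c' := by
      rw [← zmultiplesHom_apply, map_sum]
      exact Finset.sum_congr rfl fun y _ ↦ by rw [zmultiplesHom_apply, hconj y, natCast_zsmul]
    rw [hsum]
    exact resLe_relCores_eq_sum_levelConj p S θ k h hU hU' hN ht c'
  -- apply `cor` and use `cor ∘ res = index`
  have h2 := congrArg (relCores p S θ h hU hU' k 1) hres
  rwa [relCores_resLe_eq_index_smul p S θ k h hU hU' hN, map_zsmul] at h2

/-- **The θ-twisted corestriction of the class of a `U`-fixed radicand is killed by `[U : U′]` whenever `p^k ∣ Σ_y (θ(t_y) mod p^k)`** — e.g. `θ`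
quadratic, non-trivial on `U/U′ ≅ C₂`: the sum is `1 + (p^k − 1) = p^k`, so `2·cor_{F/K̃}(κ_k(u) ⊗ t_θ) = 0` for every unit `u` of `K̃ ⊂ F = K_θK̃`
(the «units from the θ-fixed subfield» mechanism of hZC). [cite: JohnsonLeungKings2011, §3.3 (5) and §5.4 (arXiv p0010:L61–70, p0015:L159–161)] [cite: NeukirchSchmidtWingberg2008, I §5 Cor. 1.5.7] -/
theorem index_smul_relCores_eq_zero_of_dvd_sum [U'.Normal] (h : U' ≤ U) (hU : IsOpen (U : Set (absoluteGaloisGroup K)))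
    (hU' : IsOpen (U' : Set (absoluteGaloisGroup K))) (hN : ramificationSubgroup K S ≤ U') (hθU' : ∀ σ ∈ U', θ σ = 1)
    (hμN : ∀ τ ∈ ramificationSubgroup K S, ∀ ζ : (AlgebraicClosure K)ˣ, ζ ^ (p ^ k) = 1 → τ • ζ = ζ)
    [Fintype (U ⧸ U'.subgroupOf U)] {t : U ⧸ U'.subgroupOf U → U} (ht : ∀ y, (t y : U ⧸ U'.subgroupOf U) = y)
    (hsum : ((p : ℤ) ^ k) ∣ ∑ y, ((PadicInt.toZModPow k ((θ ((t y : U) : absoluteGaloisGroup K) : ℤ_[p]ˣ) : ℤ_[p])).val : ℤ))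
    {u β : (AlgebraicClosure K)ˣ} (hu : ∀ σ ∈ U, σ • u = u) (hβ : β ^ (p ^ k) = u) {c' : levelCoh p S θ U' k 1}
    (hc' : IsTwistedKummerClass p θ S U' k β c') :
    ((U'.subgroupOf U).index : ℤ) • relCores p S θ h hU hU' k 1 c' = 0 := by
  obtain ⟨q, hq⟩ := hsum
  rw [index_smul_relCores_eq_sum_smul p S θ k h hU hU' hN hθU' hμN ht hu hβ hc', hq, mul_comm, mul_zsmul, ← Nat.cast_pow,
    natCast_zsmul, levelCoh_torsion p S θ hU k 1, zsmul_zero]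

end Summit.BirchSwinnertonDyer.BirchSwinnertonDyer.Theorems.PrintCf2.TwistedZeta

end
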